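import Summits.Ventures.PercRepro.RankLevelSetBiIndepContainSkew
import Summits.Ventures.PercRepro.RankLevelSetBiIndepSumPerElem

/-! # RankLevelSetBiIndepContainSkewSum — THE CONTAIN-SET SKEWNESS (CX*) PASSES TO A DIRECT SUM FOR CONTAIN-SETS
INSIDE ONE SUMMAND, GIVEN THE MONOTONE PROFILE OF THE OTHER (night-1 g28; dossier §40.13)

For `X ⊆ E_M` the contain-`X` profile of `M ⊕ N` convolves: `α^X_k(M ⊕ N) = Σ_{a ≤ k} α^X_a(M) · D_{k−a}(N)`
(`biContainCount_disjointSum`, from g24's `ncard_biIndep_disjointSum_filter`). Reflecting the index `a ↦ n₁ − 1 − a`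
and using the complement symmetry `D_{n₂−t}(N) = D_t(N)`, the level `n − 1 − k` of the sum is
`α^X_{n₁}(M) · D_{k+1}(N) + Σ_{a ≤ k} ᾱ_a · D_{k−a}(N)` with `ᾱ_a = α^X_{n₁−1−a}(M)` for `a < n₁` (`sum_conv_reflect`),
so `α^X_{n−1−k}(M ⊕ N) − α^X_k(M ⊕ N)` is the convolution of the antisymmetric skew difference `ᾱ − α` with the profile
of `N`, plus the nonnegative boundary terms `α^X_{n₁}(M)(D_{k+1}(N) − D_{k−n₁}(N))`; g24's pairing lemma `conv_nonneg`
(which needs `BiIndepMono N`) gives **`biContainSkew_disjointSum_left : BiContainSkew M → BiIndepMono N → (CX*) for`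
`M ⊕ N at every X ⊆ E_M`** — the same mechanism as the cell's direct-sum closure of (★★). Contain-sets meeting BOTH
summands are NOT covered (the convolution of two skewed sequences; census-clean, dossier §40.12 (b)). Every
declaration has a docstring; imports: the cell's own modules and Mathlib only. Axioms: standard. -/

namespace PercRepro

open Set Matroid Finset

variable {α : Type}

/-! ## The convolution identity for contain-sets inside a summand -/

variable {M N : Matroid α} [M.Finite] [N.Finite] {h : Disjoint M.E N.E}

/-- **The contain-`X` count of a direct sum convolves** for `X ⊆ E_M`:
`α^X_k(M ⊕ N) = Σ_{a ≤ k} α^X_a(M) · D_{k−a}(N)`. -/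
theorem biContainCount_disjointSum {X : Set α} (hX : X ⊆ M.E) (k : ℕ) :
    biContainCount (M.disjointSum N h) X k =
      ∑ a ∈ Finset.range (k + 1), biContainCount M X a * biIndepCount N (k - a) := by
  have e : {Z ∈ biIndep (M.disjointSum N h) k | X ⊆ Z} = {Z ∈ biIndep (M.disjointSum N h) k | X ⊆ Z ∩ M.E} := by
    ext Z
    simp only [Set.mem_setOf_eq]
    constructor
    · rintro ⟨hZ, hXZ⟩; exact ⟨hZ, Set.subset_inter hXZ hX⟩
    · rintro ⟨hZ, hXZ⟩; exact ⟨hZ, hXZ.trans Set.inter_subset_left⟩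
  unfold biContainCount
  rw [e, ncard_biIndep_disjointSum_filter (h := h) (fun T => X ⊆ T) k]
  rfl

/-! ## The reflected convolution -/

/-- **Reflecting a convolution about `(n₁ − 1)/2`**: for `α` supported on `[0, n₁]` and `D` supported on `[0, n₂]`
with the complement symmetry `D (n₂ − t) = D t`, and `2k + 1 < n₁ + n₂`,
`Σ_{a < n₁+n₂−k} α a · D (n₁+n₂−1−k−a) = α n₁ · D (k + 1) + Σ_{a ≤ k} ᾱ a · D (k − a)` where `ᾱ a = α (n₁ − 1 − a)`
for `a < n₁` and `0` beyond. -/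
lemma sum_conv_reflect (α D : ℕ → ℕ) (n₁ n₂ k : ℕ) (hα : ∀ a, n₁ < a → α a = 0) (hD0 : ∀ t, n₂ < t → D t = 0)
    (hDsym : ∀ t, t ≤ n₂ → D (n₂ - t) = D t) (hk : 2 * k + 1 < n₁ + n₂) :
    ∑ a ∈ Finset.range (n₁ + n₂ - k), α a * D (n₁ + n₂ - 1 - k - a) =
      α n₁ * D (k + 1) + ∑ a ∈ Finset.range (k + 1), (if a < n₁ then α (n₁ - 1 - a) else 0) * D (k - a) := by
  classical
  -- the left side as a sum over `range (n₁ + 1)` with an indicator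
  have hL1 : ∑ a ∈ Finset.range (n₁ + n₂ - k), α a * D (n₁ + n₂ - 1 - k - a) =
      ∑ a ∈ Finset.range (n₁ + n₂ + 1), (if a ≤ n₁ + n₂ - 1 - k then α a * D (n₁ + n₂ - 1 - k - a) else 0) := by
    have h1 : ∑ a ∈ Finset.range (n₁ + n₂ - k), α a * D (n₁ + n₂ - 1 - k - a) =
        ∑ a ∈ Finset.range (n₁ + n₂ - k), (if a ≤ n₁ + n₂ - 1 - k then α a * D (n₁ + n₂ - 1 - k - a) else 0) := by
      refine Finset.sum_congr rfl (fun a ha => ?_)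
      rw [Finset.mem_range] at ha
      have hc : a ≤ n₁ + n₂ - 1 - k := by omega
      rw [if_pos hc]
    rw [h1]
    refine Finset.sum_subset (Finset.range_subset_range.mpr (show n₁ + n₂ - k ≤ n₁ + n₂ + 1 by omega)) (fun a _ ha => ?_)
    rw [Finset.mem_range, not_lt] at ha
    have hc : ¬ a ≤ n₁ + n₂ - 1 - k := by omega
    rw [if_neg hc]
  have hL2 : ∑ a ∈ Finset.range (n₁ + n₂ + 1), (if a ≤ n₁ + n₂ - 1 - k then α a * D (n₁ + n₂ - 1 - k - a) else 0) =
      ∑ a ∈ Finset.range (n₁ + 1), (if a ≤ n₁ + n₂ - 1 - k then α a * D (n₁ + n₂ - 1 - k - a) else 0) := by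
    symm
    refine Finset.sum_subset (Finset.range_subset_range.mpr (show n₁ + 1 ≤ n₁ + n₂ + 1 by omega)) (fun a _ ha => ?_)
    rw [Finset.mem_range, not_lt] at ha
    have h0 : α a = 0 := hα a (by omega)
    rw [h0, zero_mul, ite_self]
  -- the right side as a sum over `range n₁` with an indicator
  have hR1 : ∑ a ∈ Finset.range (k + 1), (if a < n₁ then α (n₁ - 1 - a) else 0) * D (k - a) =
      ∑ a ∈ Finset.range (n₁ + n₂ + 1), (if a < n₁ ∧ a ≤ k then α (n₁ - 1 - a) * D (k - a) else 0) := by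
    have h1 : ∑ a ∈ Finset.range (k + 1), (if a < n₁ then α (n₁ - 1 - a) else 0) * D (k - a) =
        ∑ a ∈ Finset.range (k + 1), (if a < n₁ ∧ a ≤ k then α (n₁ - 1 - a) * D (k - a) else 0) := by
      refine Finset.sum_congr rfl (fun a ha => ?_)
      rw [Finset.mem_range] at ha
      have hak : a ≤ k := by omega
      by_cases h : a < n₁
      · rw [if_pos h, if_pos ⟨h, hak⟩]
      · rw [if_neg h, if_neg (fun h' => h h'.1), zero_mul]
    rw [h1]
    refine Finset.sum_subset (Finset.range_subset_range.mpr (show k + 1 ≤ n₁ + n₂ + 1 by omega)) (fun a _ ha => ?_)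
    rw [Finset.mem_range, not_lt] at ha
    have hc : ¬ (a < n₁ ∧ a ≤ k) := fun h' => by omega
    rw [if_neg hc]
  have hR2 : ∑ a ∈ Finset.range (n₁ + n₂ + 1), (if a < n₁ ∧ a ≤ k then α (n₁ - 1 - a) * D (k - a) else 0) =
      ∑ a ∈ Finset.range n₁, (if a ≤ k then α (n₁ - 1 - a) * D (k - a) else 0) := by
    symm
    have h1 : ∑ a ∈ Finset.range n₁, (if a ≤ k then α (n₁ - 1 - a) * D (k - a) else 0) =
        ∑ a ∈ Finset.range n₁, (if a < n₁ ∧ a ≤ k then α (n₁ - 1 - a) * D (k - a) else 0) := by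
      refine Finset.sum_congr rfl (fun a ha => ?_)
      rw [Finset.mem_range] at ha
      by_cases h : a ≤ k
      · rw [if_pos h, if_pos ⟨ha, h⟩]
      · rw [if_neg h, if_neg (fun h' => h h'.2)]
    rw [h1]
    refine Finset.sum_subset (Finset.range_subset_range.mpr (show n₁ ≤ n₁ + n₂ + 1 by omega)) (fun a _ ha => ?_)
    rw [Finset.mem_range, not_lt] at ha
    have hc : ¬ (a < n₁ ∧ a ≤ k) := fun h' => by omega
    rw [if_neg hc]
  rw [hL1, hL2, hR1, hR2, Finset.sum_range_succ,
    ← Finset.sum_range_reflect (fun a => if a ≤ k then α (n₁ - 1 - a) * D (k - a) else 0) n₁, add_comm]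
  congr 1
  · -- the `a = n₁` term
    by_cases hkn : k + 1 ≤ n₂
    · have hc : n₁ ≤ n₁ + n₂ - 1 - k := by omega
      rw [if_pos hc, show n₁ + n₂ - 1 - k - n₁ = n₂ - (k + 1) by omega, hDsym (k + 1) hkn]
    · have hc : ¬ n₁ ≤ n₁ + n₂ - 1 - k := by omega
      rw [if_neg hc, hD0 (k + 1) (by omega), mul_zero]
  · refine Finset.sum_congr rfl (fun a ha => ?_)
    rw [Finset.mem_range] at ha
    simp only [show n₁ - 1 - (n₁ - 1 - a) = a by omega]
    by_cases h1 : a ≤ n₁ + n₂ - 1 - k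
    · by_cases h2 : n₁ - 1 - a ≤ k
      · rw [if_pos h1, if_pos h2]
        have : n₁ + n₂ - 1 - k - a = n₂ - (k - (n₁ - 1 - a)) := by omega
        rw [this, hDsym _ (by omega)]
      · rw [if_pos h1, if_neg h2, hD0 _ (by omega), mul_zero]
    · by_cases h2 : n₁ - 1 - a ≤ k
      · rw [if_neg h1, if_pos h2, hD0 (k - (n₁ - 1 - a)) (by omega), mul_zero]
      · rw [if_neg h1, if_neg h2]

/-! ## The closure theorem -/

/-- `α^X_a(M) = 0` beyond the ground set. -/
lemma biContainCount_eq_zero_of_lt (X : Set α) {a : ℕ} (ha : M.E.ncard < a) : biContainCount M X a = 0 := by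
  unfold biContainCount
  rw [biIndep_eq_empty_of_lt M ha]
  simp

/-- `D_t(N) = 0` beyond the ground set. -/
lemma biIndepCount_eq_zero_of_lt {t : ℕ} (ht : N.E.ncard < t) : biIndepCount N t = 0 := by
  unfold biIndepCount
  rw [biIndep_eq_empty_of_lt N ht, Set.ncard_empty]

/-- **(CX*) PASSES TO A DIRECT SUM FOR CONTAIN-SETS INSIDE THE FIRST SUMMAND**: if `M` satisfies (CX*) and `N` has the
monotone profile, then for every `X ⊆ E_M` and `2k + 1 < #E(M ⊕ N)`,
`α^X_k(M ⊕ N) ≤ α^X_{#E − 1 − k}(M ⊕ N)`. -/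
theorem biContainSkew_disjointSum_left (hM : BiContainSkew M) (hN : BiIndepMono N) {X : Set α} (hX : X ⊆ M.E)
    {k : ℕ} (hk : 2 * k + 1 < (M.disjointSum N h).E.ncard) :
    biContainCount (M.disjointSum N h) X k ≤
      biContainCount (M.disjointSum N h) X ((M.disjointSum N h).E.ncard - 1 - k) := by
  classical
  have hn : (M.disjointSum N h).E.ncard = M.E.ncard + N.E.ncard := by
    rw [Matroid.disjointSum_ground_eq, Set.ncard_union_eq h M.ground_finite N.ground_finite]
  rw [hn] at hk ⊢
  set n₁ := M.E.ncard with hn₁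
  set n₂ := N.E.ncard with hn₂
  set α : ℕ → ℕ := fun a => biContainCount M X a with hα
  set D : ℕ → ℕ := fun t => biIndepCount N t with hD
  rw [biContainCount_disjointSum (h := h) hX k, biContainCount_disjointSum (h := h) hX (n₁ + n₂ - 1 - k)]
  have hrange : n₁ + n₂ - 1 - k + 1 = n₁ + n₂ - k := by omega
  rw [hrange]
  have hrefl := sum_conv_reflect α D n₁ n₂ k (fun a ha => biContainCount_eq_zero_of_lt X ha)
    (fun t ht => biIndepCount_eq_zero_of_lt ht) (fun t ht => biIndepCount_compl N t ht) hk
  simp only [hα, hD] at hrefl ⊢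
  rw [hrefl]
  -- split the left side at `a = n₁`
  have hsplit : ∑ a ∈ Finset.range (k + 1), biContainCount M X a * biIndepCount N (k - a) =
      ∑ a ∈ Finset.range (k + 1), (if a < n₁ then biContainCount M X a else 0) * biIndepCount N (k - a) +
        (if n₁ ≤ k then biContainCount M X n₁ * biIndepCount N (k - n₁) else 0) := by
    have e : ∀ a ∈ Finset.range (k + 1), biContainCount M X a * biIndepCount N (k - a) =
        (if a < n₁ then biContainCount M X a else 0) * biIndepCount N (k - a) +
          (if a = n₁ then biContainCount M X n₁ * biIndepCount N (k - n₁) else 0) := by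
      intro a _
      by_cases h1 : a < n₁
      · rw [if_pos h1, if_neg (by omega), add_zero]
      · by_cases h2 : a = n₁
        · subst h2; rw [if_neg h1, if_pos rfl, zero_mul, zero_add]
        · rw [if_neg h1, if_neg h2, zero_mul, biContainCount_eq_zero_of_lt X (by omega), zero_mul, add_zero]
    rw [Finset.sum_congr rfl e, Finset.sum_add_distrib, Finset.sum_ite_eq' (Finset.range (k + 1)) n₁]
    congr 1
    by_cases hnk : n₁ ≤ k
    · rw [if_pos (Finset.mem_range.mpr (by omega)), if_pos hnk]
    · rw [if_neg (fun hmem => hnk (by rw [Finset.mem_range] at hmem; omega)), if_neg hnk]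
  rw [hsplit]
  -- the boundary term
  have hbdry : (if n₁ ≤ k then biContainCount M X n₁ * biIndepCount N (k - n₁) else 0) ≤
      biContainCount M X n₁ * biIndepCount N (k + 1) := by
    split_ifs with hnk
    · exact Nat.mul_le_mul_left _ (biIndepCount_le_of_mono N hN (by omega) (by omega))
    · exact Nat.zero_le _
  -- the pairing lemma on the reflected difference
  set Δ : ℕ → ℤ := fun a => if a < n₁ then (biContainCount M X (n₁ - 1 - a) : ℤ) - (biContainCount M X a : ℤ) else 0
    with hΔ
  have key := conv_nonneg Δ (fun t => biIndepCount N t) n₁ n₂ k ?_ ?_ ?_ ?_ hk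
  · have hmain : ∑ a ∈ Finset.range (k + 1), (if a < n₁ then biContainCount M X a else 0) * biIndepCount N (k - a) ≤
        ∑ a ∈ Finset.range (k + 1), (if a < n₁ then biContainCount M X (n₁ - 1 - a) else 0) * biIndepCount N (k - a) := by
      have e : ∑ a ∈ Finset.range (k + 1), Δ a * ((biIndepCount N (k - a) : ℕ) : ℤ) =
          (∑ a ∈ Finset.range (k + 1),
            (if a < n₁ then biContainCount M X (n₁ - 1 - a) else 0) * biIndepCount N (k - a) : ℕ) -
          (∑ a ∈ Finset.range (k + 1), (if a < n₁ then biContainCount M X a else 0) * biIndepCount N (k - a) : ℕ) := by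
        push_cast
        rw [← Finset.sum_sub_distrib]
        refine Finset.sum_congr rfl (fun a _ => ?_)
        simp only [hΔ]
        split_ifs <;> ring
      rw [e] at key
      have := sub_nonneg.mp key
      exact_mod_cast this
    calc ∑ a ∈ Finset.range (k + 1), (if a < n₁ then biContainCount M X a else 0) * biIndepCount N (k - a) +
          (if n₁ ≤ k then biContainCount M X n₁ * biIndepCount N (k - n₁) else 0)
        ≤ ∑ a ∈ Finset.range (k + 1), (if a < n₁ then biContainCount M X (n₁ - 1 - a) else 0) *
            biIndepCount N (k - a) + biContainCount M X n₁ * biIndepCount N (k + 1) := Nat.add_le_add hmain hbdry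
      _ = _ := by ring
  · intro a ha
    simp only [hΔ]
    rw [if_pos (by omega)]
    have := hM X hX a ha
    have h' : ((biContainCount M X a : ℕ) : ℤ) ≤ ((biContainCount M X (n₁ - 1 - a) : ℕ) : ℤ) := by exact_mod_cast this
    linarith
  · intro a ha
    simp only [hΔ]
    rw [if_pos (by omega), if_pos (by omega), show n₁ - 1 - (n₁ - 1 - a) = a by omega]
    ring
  · intro a ha
    simp only [hΔ]
    rw [if_neg (by omega)]
  · intro x' x hxx hsum
    exact biIndepCount_le_of_mono N hN hxx hsum

end PercRepro
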